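import Mathlib
import HarnessLib
import Summits.Ventures.LatticeQCDFlow.Scoring.SymmetricSamplerOddObservables
import Summits.Ventures.LatticeQCDFlow.Exactness.DoeblinAutocovariance
import Summits.Ventures.LatticeQCDFlow.Scoring.HMCKernelSymmetry

/-!
# Two independent replicas of one sampler from one initial law: the pair chain commutes with the replica swap, so every replica-antisymmetric statistic is centred with a symmetric law at EVERY step

HONEST FRAMING: exact (Metropolis-corrected) sampling algorithms for lattice gauge theory;
figures of merit are autocorrelation/cost numbers at stated couplings and volumes; no
continuum-physics claim.

Venture `LatticeQCDFlow` (cell pub-lqcd), sub-topic `Scoring`, FANOUT row 21 (`su3-base`: every instance is run as TWO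
independent streams `s0`, `s1` of the same algorithm from the same kind of start, and the thermalisation / consistency cut
C-1 asks the two streams' running means to agree within errors).  NEW WORK of the cell over Mathlib's parallel product of
kernels (`Kernel.parallelComp`, `κ ∥ₖ η`; `parallelComp_apply`, `parallelComp_comp_parallelComp`, `id_parallelComp_id`,
`Measure.prod_swap`), row 7's `Exactness/TransformedKernel` (`conjKernel`), row 16's `Scoring/SymmetricSamplerOddObservables`
(`map_bind_nHit_eq_self`, `integral_bind_nHit_eq_zero_of_odd`, `bind_nHit_tail_symm_of_odd` for a `Θ`-symmetric kernel from
a `Θ`-invariant start) and `Exactness/DoeblinAutocovariance` (`isMarkovKernel_nHit`).  Def-free; nothing is cited as a fact;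
no number.

## What is proved (`κ : Kernel Ω Ω` Markov — ONE sampler; the pair chain is `κ ∥ₖ κ` on `Ω × Ω`; `Θ = prodComm` the swap)

* §1 `nHit_parallelComp` — `n` steps of the pair chain = the pair of `n`-step chains: `(κ ∥ₖ κ)ⁿ = κⁿ ∥ₖ κⁿ`;
  **`conjKernel_parallelComp_prodComm`** — THE PAIR CHAIN COMMUTES WITH THE REPLICA SWAP:
  `conjKernel (κ ∥ₖ η) prodComm = η ∥ₖ κ`, in particular `conjKernel (κ ∥ₖ κ) prodComm = κ ∥ₖ κ`;
  `prod_map_prodComm` — a product start `μ₀ ⊗ μ₀` (both streams from the same initial law, independently) is swap-invariant.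
* §2 consequences at EVERY step `n` (thermalised or not), for every real statistic `D` of the pair that is ANTISYMMETRIC under
  the swap (`D(y, x) = −D(x, y)`: the difference of the two streams' values of any observable, of their running means over
  equal windows, any odd function of such differences): **`integral_twoReplica_eq_zero_of_antisymm`** — `𝔼[D(X_n, Y_n)] = 0`;
  **`twoReplica_tail_symm_of_antisymm`** — `P(c ≤ D(X_n, Y_n)) = P(D(X_n, Y_n) ≤ −c)` for every real `c`; and the law of the pair
  is exchangeable at every step (`twoReplica_law_map_prodComm`).  Instances: `integral_sub_twoReplica_eq_zero` /
  `sub_twoReplica_tail_symm` for `D = f(x) − f(y)`, any real observable `f`.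
* §3 ARM E2 INSTANCE (row 16's `hmcKernel B β ε w` — Gaussian refresh, any kick–drift trajectory, Metropolis test — needs no
  symmetry of its own here, only independence of the two copies): `integral_sub_twoStream_hmc_eq_zero`, `sub_twoStream_hmc_tail_symm`,
  and the two-cold-streams / two-hot-streams corollaries `integral_sub_twoColdStream_hmc_eq_zero`, `integral_sub_twoHotStream_hmc_eq_zero`.
So the null distribution of the two-stream agreement statistic is symmetric about `0` at every step for ANY exact or inexact
Markov sampler, as long as the two streams run the same kernel independently from the same initial law — the C-1 comparison
needs no equilibrium for its centring, only for its error bars.  NOT CLAIMED: the size of the fluctuations of `D` (that is the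
`τ_int` / error-bar business of the scorers); anything when the two streams use different kernels, different starts, or share
randomness; numbers.
-/

noncomputable section

namespace Summit.Ventures.LatticeQCDFlow.Scoring

open MeasureTheory ProbabilityTheory ProbabilityTheory.Kernel
open Summit.Ventures.LatticeQCDFlow.Exactness (conjKernel conjKernel_apply nHit nHit_zero nHit_succ isMarkovKernel_nHit)

variable {Ω : Type*} [MeasurableSpace Ω]

/-! ## §1 The pair chain: powers, swap symmetry, swap-invariant starts -/

section Pair

/-- **`n` steps of the pair chain are the pair of `n`-step chains**: `(κ ∥ₖ η)ⁿ = κⁿ ∥ₖ ηⁿ`. -/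
theorem nHit_parallelComp (κ η : Kernel Ω Ω) [IsMarkovKernel κ] [IsMarkovKernel η] :
    ∀ n, nHit (κ ∥ₖ η) n = nHit κ n ∥ₖ nHit η n
  | 0 => by rw [nHit_zero, nHit_zero, nHit_zero, Kernel.id_parallelComp_id]
  | n + 1 => by
    haveI := isMarkovKernel_nHit κ n
    haveI := isMarkovKernel_nHit η n
    rw [nHit_succ, nHit_succ, nHit_succ, nHit_parallelComp κ η n, Kernel.parallelComp_comp_parallelComp]

/-- **THE PAIR CHAIN REPORTED THROUGH THE REPLICA SWAP IS THE SWAPPED PAIR CHAIN**: `conjKernel (κ ∥ₖ η) prodComm = η ∥ₖ κ`. -/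
theorem conjKernel_parallelComp_prodComm (κ η : Kernel Ω Ω) [IsMarkovKernel κ] [IsMarkovKernel η] :
    conjKernel (κ ∥ₖ η) (MeasurableEquiv.prodComm : Ω × Ω ≃ᵐ Ω × Ω) = η ∥ₖ κ := by
  ext x s hs
  rw [conjKernel_apply, Kernel.parallelComp_apply, Kernel.parallelComp_apply]
  change ((κ x.2).prod (η x.1)).map Prod.swap s = _
  rw [Measure.prod_swap]

/-- **Two independent copies of ONE sampler commute with the replica swap**: `conjKernel (κ ∥ₖ κ) prodComm = κ ∥ₖ κ`. -/
theorem conjKernel_twoReplica_prodComm (κ : Kernel Ω Ω) [IsMarkovKernel κ] :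
    conjKernel (κ ∥ₖ κ) (MeasurableEquiv.prodComm : Ω × Ω ≃ᵐ Ω × Ω) = κ ∥ₖ κ :=
  conjKernel_parallelComp_prodComm κ κ

/-- **A product start from one initial law is swap-invariant**: `(μ₀ ⊗ μ₀) ∘ swap⁻¹ = μ₀ ⊗ μ₀`. -/
theorem prod_map_prodComm (μ₀ : Measure Ω) [SFinite μ₀] :
    (μ₀.prod μ₀).map (MeasurableEquiv.prodComm : Ω × Ω ≃ᵐ Ω × Ω) = μ₀.prod μ₀ :=
  Measure.prod_swap

end Pair

/-! ## §2 Antisymmetric pair statistics are centred with symmetric law at every step -/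

section Antisymm

variable (κ : Kernel Ω Ω) [IsMarkovKernel κ] (μ₀ : Measure Ω) [SFinite μ₀]

/-- **The law of the pair `(X_n, Y_n)` is exchangeable at every step** (two independent copies of `κ` from `μ₀ ⊗ μ₀`). -/
theorem twoReplica_law_map_prodComm (n : ℕ) :
    ((μ₀.prod μ₀).bind (nHit (κ ∥ₖ κ) n)).map (MeasurableEquiv.prodComm : Ω × Ω ≃ᵐ Ω × Ω) =
      (μ₀.prod μ₀).bind (nHit (κ ∥ₖ κ) n) :=
  map_bind_nHit_eq_self (conjKernel_twoReplica_prodComm κ) (prod_map_prodComm μ₀) n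

/-- **`𝔼[D(X_n, Y_n)] = 0` AT EVERY STEP** for every swap-antisymmetric statistic `D` (`D(y, x) = −D(x, y)`; no integrability
needed), two independent copies of `κ` from `μ₀ ⊗ μ₀`. -/
theorem integral_twoReplica_eq_zero_of_antisymm {E : Type*} [NormedAddCommGroup E] [NormedSpace ℝ E] {D : Ω × Ω → E}
    (hD : ∀ z : Ω × Ω, D (z.2, z.1) = -D z) (n : ℕ) :
    ∫ z, D z ∂((μ₀.prod μ₀).bind (nHit (κ ∥ₖ κ) n)) = 0 :=
  integral_bind_nHit_eq_zero_of_odd (conjKernel_twoReplica_prodComm κ) (prod_map_prodComm μ₀) (fun z => hD z) n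

/-- **`P(c ≤ D(X_n, Y_n)) = P(D(X_n, Y_n) ≤ −c)` AT EVERY STEP**, every real `c`, every swap-antisymmetric real `D`. -/
theorem twoReplica_tail_symm_of_antisymm {D : Ω × Ω → ℝ} (hD : ∀ z : Ω × Ω, D (z.2, z.1) = -D z) (n : ℕ) (c : ℝ) :
    ((μ₀.prod μ₀).bind (nHit (κ ∥ₖ κ) n)) {z | c ≤ D z} = ((μ₀.prod μ₀).bind (nHit (κ ∥ₖ κ) n)) {z | D z ≤ -c} :=
  bind_nHit_tail_symm_of_odd (conjKernel_twoReplica_prodComm κ) (prod_map_prodComm μ₀) (fun z => hD z) n c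

/-- **The difference of the two streams' values of any observable is centred at every step**: `𝔼[f(X_n) − f(Y_n)] = 0`. -/
theorem integral_sub_twoReplica_eq_zero {E : Type*} [NormedAddCommGroup E] [NormedSpace ℝ E] (f : Ω → E) (n : ℕ) :
    ∫ z, (f z.1 - f z.2) ∂((μ₀.prod μ₀).bind (nHit (κ ∥ₖ κ) n)) = 0 :=
  integral_twoReplica_eq_zero_of_antisymm κ μ₀ (D := fun z => f z.1 - f z.2) (fun z => by simp only [neg_sub]) n

/-- **and has symmetric tails at every step**: `P(c ≤ f(X_n) − f(Y_n)) = P(f(X_n) − f(Y_n) ≤ −c)`. -/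
theorem sub_twoReplica_tail_symm (f : Ω → ℝ) (n : ℕ) (c : ℝ) :
    ((μ₀.prod μ₀).bind (nHit (κ ∥ₖ κ) n)) {z | c ≤ f z.1 - f z.2} =
      ((μ₀.prod μ₀).bind (nHit (κ ∥ₖ κ) n)) {z | f z.1 - f z.2 ≤ -c} :=
  twoReplica_tail_symm_of_antisymm κ μ₀ (D := fun z => f z.1 - f z.2) (fun z => by simp only [neg_sub]) n c

end Antisymm

/-! ## §3 Arm E2: two independent HMC streams from the same start -/

section ArmE2

open Literature.MathematicalPhysics.QuantumFieldTheory

variable {d L n : ℕ} [NeZero L] (B : Literature.MathematicalPhysics.QuantumFieldTheory.Luscher2010.SuBasis n) (β ε : ℝ)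
  (w : List MDOp)

/-- **ARM E2, TWO STREAMS (row 16's HMC kernel `hmcKernel B β ε w`, any coupling, step, kick–drift word): from any common initial law
`μ₀` run twice independently, the difference of the two streams' values of ANY observable `f` is centred at every step `N`.** -/
theorem integral_sub_twoStream_hmc_eq_zero (μ₀ : Measure (GaugeConfig d L (Matrix.specialUnitaryGroup (Fin n) ℂ))) [SFinite μ₀]
    {E : Type*} [NormedAddCommGroup E] [NormedSpace ℝ E] (f : GaugeConfig d L (Matrix.specialUnitaryGroup (Fin n) ℂ) → E) (N : ℕ) :
    ∫ z, (f z.1 - f z.2) ∂((μ₀.prod μ₀).bind (nHit (hmcKernel B β ε w ∥ₖ hmcKernel B β ε w) N)) = 0 :=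
  integral_sub_twoReplica_eq_zero (hmcKernel B β ε w) μ₀ f N

/-- **… and has symmetric tails at every step**: `P(c ≤ f(X_N) − f(Y_N)) = P(f(X_N) − f(Y_N) ≤ −c)`. -/
theorem sub_twoStream_hmc_tail_symm (μ₀ : Measure (GaugeConfig d L (Matrix.specialUnitaryGroup (Fin n) ℂ))) [SFinite μ₀]
    (f : GaugeConfig d L (Matrix.specialUnitaryGroup (Fin n) ℂ) → ℝ) (N : ℕ) (c : ℝ) :
    ((μ₀.prod μ₀).bind (nHit (hmcKernel B β ε w ∥ₖ hmcKernel B β ε w) N)) {z | c ≤ f z.1 - f z.2} =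
      ((μ₀.prod μ₀).bind (nHit (hmcKernel B β ε w ∥ₖ hmcKernel B β ε w) N)) {z | f z.1 - f z.2 ≤ -c} :=
  sub_twoReplica_tail_symm (hmcKernel B β ε w) μ₀ f N c

/-- **Two COLD streams** (`U ≡ 1` twice, the row's `s0` / `s1` from cold): `𝔼[f(X_N) − f(Y_N)] = 0` at every step. -/
theorem integral_sub_twoColdStream_hmc_eq_zero {E : Type*} [NormedAddCommGroup E] [NormedSpace ℝ E]
    (f : GaugeConfig d L (Matrix.specialUnitaryGroup (Fin n) ℂ) → E) (N : ℕ) :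
    ∫ z, (f z.1 - f z.2) ∂(((Measure.dirac (1 : GaugeConfig d L (Matrix.specialUnitaryGroup (Fin n) ℂ))).prod
        (Measure.dirac 1)).bind (nHit (hmcKernel B β ε w ∥ₖ hmcKernel B β ε w) N)) = 0 :=
  integral_sub_twoStream_hmc_eq_zero B β ε w (Measure.dirac 1) f N

/-- **Two HOT streams** (`∏ dHaar` twice, independently): `𝔼[f(X_N) − f(Y_N)] = 0` at every step. -/
theorem integral_sub_twoHotStream_hmc_eq_zero {E : Type*} [NormedAddCommGroup E] [NormedSpace ℝ E]
    (f : GaugeConfig d L (Matrix.specialUnitaryGroup (Fin n) ℂ) → E) (N : ℕ) :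
    ∫ z, (f z.1 - f z.2) ∂(((Measure.pi fun _ : Edge d L => haarProbability (Matrix.specialUnitaryGroup (Fin n) ℂ)).prod
        (Measure.pi fun _ : Edge d L => haarProbability (Matrix.specialUnitaryGroup (Fin n) ℂ))).bind
        (nHit (hmcKernel B β ε w ∥ₖ hmcKernel B β ε w) N)) = 0 :=
  integral_sub_twoStream_hmc_eq_zero B β ε w _ f N

end ArmE2

end Summit.Ventures.LatticeQCDFlow.Scoring
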